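import Mathlib
import Summits.ValiantsHypothesis.ValiantsHypothesis.Theorems.DivisionGapPerMultiplesHardOrderedFactorFirstMoment

/-!
# `DivisionGap.PerMultiplesHard` (stmt-ValiantsHypothesis-5068), line `uncharged-face-walk`:
the ORDERED FACTOR, part 3 of 5 — statistics of a REPAIRED order, and the real/ℕ bookkeeping (lead c8, cycle 8)

(i) Perturbation: if the consecutive value pairs of `ρ'` differ from those of `ρ` exactly on the position set `C`, then
`dev₁ ρ' ≤ dev₁ ρ + a·#C` (`dev₁_perturb`), every column keeps all but `#C` of its consecutive pairs (`colW_perturb`),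
and the 4-wise statistic along non-adjacent pairs at any level `c ∈ [0, a]` is `≤ dev₂ ρ + a²|c₄ − c| + 2a²·#C`
(`dev₂_perturb`; pointwise `quad_perturb_pt`); `sum_erase_le_nonAdj` adds the `2a` of the two adjacent positions.
(ii) Bookkeeping for the composition: `arith_eta` (`3η₁ + η₂ + 1/a ≤ 1/R` for `D₃ = 512R`, `E = 2048R`, `a ≥ 1024R`),
`sqrt_bound` (`√(ε/q) ≤ 1/(4Q)` from `ε ≤ √(1/R)`, `R = (16Q²D₂)²`, `qD₂ ≥ 1`), `nat_le_div_add`, `nat_L`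
(`min t (w − #C) ≥ a/(2Q)`), `aux_key`, `aux1`–`aux5`. Elementary. [folklore]
-/

noncomputable section

-- `Summit.ValiantsHypothesis.ValiantsHypothesis.…` is the tree's mandated layout (Sub = Summit).
set_option linter.dupNamespace false

open Finset
open scoped BigOperators

namespace Summit.ValiantsHypothesis.ValiantsHypothesis.Theorems.DivisionGap.PerMultiplesHard.OrderedFactor

variable {a : ℕ}

/-! ### Statistics of the repaired order -/

/-- `|u - v| ≤ a` for `u, v ∈ [0, a]`. -/
lemma abs_sub_le_of_mem {u v A : ℝ} (hu0 : 0 ≤ u) (huA : u ≤ A) (hv0 : 0 ≤ v) (hvA : v ≤ A) : |u - v| ≤ A := by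
  rw [abs_sub_le_iff]; constructor <;> linarith

/-- Row statistics after a perturbation of the consecutive pairs on a set `C`. -/
lemma dev₁_perturb (X : Finset (Fin a × Fin a)) (c₂ : ℝ) (hc0 : 0 ≤ c₂) (hca : c₂ ≤ a)
    (ρ ρ' : Equiv.Perm (Fin a)) :
    (∑ k : Fin a, |((((Finset.univ.filter fun yy : Fin a => (ρ' k, yy) ∈ X ∧ (ρ' ((finRotate a).symm k), yy) ∈ X).card) : ℕ) : ℝ) - c₂|) ≤ (∑ k : Fin a, |((((Finset.univ.filter fun yy : Fin a => (ρ k, yy) ∈ X ∧ (ρ ((finRotate a).symm k), yy) ∈ X).card) : ℕ) : ℝ) - c₂|) + (a : ℝ) *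
      ((Finset.univ.filter fun k : Fin a => (ρ' k, ρ' (((finRotate a).symm k))) ≠ (ρ k, ρ (((finRotate a).symm k)))).card : ℝ) := by
  classical
  set C := Finset.univ.filter fun k : Fin a => (ρ' k, ρ' (((finRotate a).symm k))) ≠ (ρ k, ρ (((finRotate a).symm k))) with hC
  have hpt : ∀ k : Fin a, |(((Finset.univ.filter fun yy : Fin a => ((ρ' k), yy) ∈ X ∧ ((ρ' (((finRotate a).symm k))), yy) ∈ X).card) : ℝ) - c₂| ≤
      |(((Finset.univ.filter fun yy : Fin a => ((ρ k), yy) ∈ X ∧ ((ρ (((finRotate a).symm k))), yy) ∈ X).card) : ℝ) - c₂| + (a : ℝ) * (if k ∈ C then 1 else 0) := by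
    intro k
    by_cases hk : k ∈ C
    · rw [if_pos hk, mul_one]
      have h1 : |(((Finset.univ.filter fun yy : Fin a => ((ρ' k), yy) ∈ X ∧ ((ρ' (((finRotate a).symm k))), yy) ∈ X).card) : ℝ) - c₂| ≤ a :=
        abs_sub_le_of_mem (by positivity) (by exact_mod_cast codeg_le X _ _) hc0 hca
      linarith [abs_nonneg ((((Finset.univ.filter fun yy : Fin a => ((ρ k), yy) ∈ X ∧ ((ρ (((finRotate a).symm k))), yy) ∈ X).card) : ℝ) - c₂)]
    · rw [if_neg hk, mul_zero, add_zero]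
      have : (ρ' k, ρ' (((finRotate a).symm k))) = (ρ k, ρ (((finRotate a).symm k))) := by
        by_contra hne; exact hk (by rw [hC]; exact Finset.mem_filter.mpr ⟨Finset.mem_univ _, hne⟩)
      obtain ⟨h1, h2⟩ := Prod.mk.inj this
      rw [h1, h2]
  calc ∑ k : Fin a, |(((Finset.univ.filter fun yy : Fin a => ((ρ' k), yy) ∈ X ∧ ((ρ' (((finRotate a).symm k))), yy) ∈ X).card) : ℝ) - c₂|
      ≤ ∑ k : Fin a, (|(((Finset.univ.filter fun yy : Fin a => ((ρ k), yy) ∈ X ∧ ((ρ (((finRotate a).symm k))), yy) ∈ X).card) : ℝ) - c₂| + (a : ℝ) * (if k ∈ C then 1 else 0)) :=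
        Finset.sum_le_sum fun k _ => hpt k
    _ = _ := by
        rw [Finset.sum_add_distrib, ← Finset.mul_sum]
        congr 1
        rw [Finset.sum_ite_mem, Finset.univ_inter, Finset.sum_const, nsmul_eq_mul, mul_one]

/-- Column degrees after a perturbation of the consecutive pairs on a set `C`. -/
lemma colW_perturb (X : Finset (Fin a × Fin a)) (ρ ρ' : Equiv.Perm (Fin a)) (y : Fin a) :
    ((Finset.univ.filter fun kk : Fin a => (ρ kk, y) ∈ X ∧ (ρ ((finRotate a).symm kk), y) ∈ X).card) ≤ ((Finset.univ.filter fun kk : Fin a => (ρ' kk, y) ∈ X ∧ (ρ' ((finRotate a).symm kk), y) ∈ X).card) +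
      (Finset.univ.filter fun k : Fin a => (ρ' k, ρ' (((finRotate a).symm k))) ≠ (ρ k, ρ (((finRotate a).symm k)))).card := by
  classical
  set C := Finset.univ.filter fun k : Fin a => (ρ' k, ρ' (((finRotate a).symm k))) ≠ (ρ k, ρ (((finRotate a).symm k))) with hC
  set A := Finset.univ.filter fun k : Fin a => (ρ k, y) ∈ X ∧ (ρ (((finRotate a).symm k)), y) ∈ X with hA
  set A' := Finset.univ.filter fun k : Fin a => (ρ' k, y) ∈ X ∧ (ρ' (((finRotate a).symm k)), y) ∈ X with hA'
  have hsub : A \ C ⊆ A' := by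
    intro k hk
    rw [Finset.mem_sdiff] at hk
    obtain ⟨hkA, hkC⟩ := hk
    have heq : (ρ' k, ρ' (((finRotate a).symm k))) = (ρ k, ρ (((finRotate a).symm k))) := by
      by_contra hne; exact hkC (by rw [hC]; exact Finset.mem_filter.mpr ⟨Finset.mem_univ _, hne⟩)
    obtain ⟨h1, h2⟩ := Prod.mk.inj heq
    simp only [hA, Finset.mem_filter, Finset.mem_univ, true_and] at hkA
    simp only [hA', Finset.mem_filter, Finset.mem_univ, true_and, h1, h2]
    exact hkA
  calc A.card ≤ (A \ C).card + C.card := Finset.card_le_card_sdiff_add_card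
    _ ≤ A'.card + C.card := by gcongr

/-- Pair statistics after a perturbation: pointwise bound. -/
lemma quad_perturb_pt (X : Finset (Fin a × Fin a)) (c₄ c : ℝ) (hc0 : 0 ≤ c) (hca : c ≤ a)
    (ρ ρ' : Equiv.Perm (Fin a)) (k k' : Fin a) :
    |(((Finset.univ.filter fun yy : Fin a => ((ρ' k), yy) ∈ X ∧ ((ρ' (((finRotate a).symm k))), yy) ∈ X ∧ ((ρ' k'), yy) ∈ X ∧ ((ρ' (((finRotate a).symm k'))), yy) ∈ X).card) : ℝ) - c| ≤
      |(((Finset.univ.filter fun yy : Fin a => ((ρ k), yy) ∈ X ∧ ((ρ (((finRotate a).symm k))), yy) ∈ X ∧ ((ρ k'), yy) ∈ X ∧ ((ρ (((finRotate a).symm k'))), yy) ∈ X).card) : ℝ) - c₄| + |c₄ - c| +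
      (a : ℝ) * (if k ∈ (Finset.univ.filter fun k : Fin a => (ρ' k, ρ' (((finRotate a).symm k))) ≠ (ρ k, ρ (((finRotate a).symm k)))) then 1 else 0) +
      (a : ℝ) * (if k' ∈ (Finset.univ.filter fun k : Fin a => (ρ' k, ρ' (((finRotate a).symm k))) ≠ (ρ k, ρ (((finRotate a).symm k)))) then 1 else 0) := by
  classical
  set C := Finset.univ.filter fun k : Fin a => (ρ' k, ρ' (((finRotate a).symm k))) ≠ (ρ k, ρ (((finRotate a).symm k))) with hC
  have hT : |(((Finset.univ.filter fun yy : Fin a => ((ρ' k), yy) ∈ X ∧ ((ρ' (((finRotate a).symm k))), yy) ∈ X ∧ ((ρ' k'), yy) ∈ X ∧ ((ρ' (((finRotate a).symm k'))), yy) ∈ X).card) : ℝ) - c| ≤ a :=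
    abs_sub_le_of_mem (by positivity) (by exact_mod_cast quad_le X _ _ _ _) hc0 hca
  have h0 : 0 ≤ |(((Finset.univ.filter fun yy : Fin a => ((ρ k), yy) ∈ X ∧ ((ρ (((finRotate a).symm k))), yy) ∈ X ∧ ((ρ k'), yy) ∈ X ∧ ((ρ (((finRotate a).symm k'))), yy) ∈ X).card) : ℝ) - c₄| + |c₄ - c| := by positivity
  by_cases hk : k ∈ C
  · rw [if_pos hk]
    have : 0 ≤ (a : ℝ) * (if k' ∈ C then 1 else 0) := by positivity
    linarith
  · by_cases hk' : k' ∈ C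
    · rw [if_pos hk', if_neg hk]
      simp only [mul_zero, add_zero, mul_one]
      linarith
    · rw [if_neg hk, if_neg hk']
      simp only [mul_zero, add_zero]
      have e1 : (ρ' k, ρ' (((finRotate a).symm k))) = (ρ k, ρ (((finRotate a).symm k))) := by
        by_contra hne; exact hk (by rw [hC]; exact Finset.mem_filter.mpr ⟨Finset.mem_univ _, hne⟩)
      have e2 : (ρ' k', ρ' (((finRotate a).symm k'))) = (ρ k', ρ (((finRotate a).symm k'))) := by
        by_contra hne; exact hk' (by rw [hC]; exact Finset.mem_filter.mpr ⟨Finset.mem_univ _, hne⟩)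
      obtain ⟨h1, h2⟩ := Prod.mk.inj e1
      obtain ⟨h3, h4⟩ := Prod.mk.inj e2
      rw [h1, h2, h3, h4]
      exact abs_sub_le _ _ _

/-- Pair statistics after a perturbation: the sum over non-adjacent pairs. -/
lemma dev₂_perturb (X : Finset (Fin a × Fin a)) (c₄ c : ℝ) (hc0 : 0 ≤ c) (hca : c ≤ a)
    (ρ ρ' : Equiv.Perm (Fin a)) :
    ∑ k : Fin a, ∑ k' ∈ (((Finset.univ.erase k).erase ((finRotate a).symm k)).erase (finRotate a k)), |(((Finset.univ.filter fun yy : Fin a => ((ρ' k), yy) ∈ X ∧ ((ρ' (((finRotate a).symm k))), yy) ∈ X ∧ ((ρ' k'), yy) ∈ X ∧ ((ρ' (((finRotate a).symm k'))), yy) ∈ X).card) : ℝ) - c| ≤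
      (∑ k : Fin a, ∑ k' ∈ (((Finset.univ.erase k).erase ((finRotate a).symm k)).erase (finRotate a k)), |((((Finset.univ.filter fun yy : Fin a => (ρ k, yy) ∈ X ∧ (ρ ((finRotate a).symm k), yy) ∈ X ∧ (ρ k', yy) ∈ X ∧ (ρ ((finRotate a).symm k'), yy) ∈ X).card) : ℕ) : ℝ) - c₄|) + (a : ℝ) * a * |c₄ - c| + 2 * ((a : ℝ) * a) *
        ((Finset.univ.filter fun k : Fin a => (ρ' k, ρ' (((finRotate a).symm k))) ≠ (ρ k, ρ (((finRotate a).symm k)))).card : ℝ) := by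
  classical
  set C := Finset.univ.filter fun k : Fin a => (ρ' k, ρ' (((finRotate a).symm k))) ≠ (ρ k, ρ (((finRotate a).symm k))) with hC
  have hCsum : ∑ k : Fin a, (if k ∈ C then (1 : ℝ) else 0) = C.card := by
    rw [Finset.sum_ite_mem, Finset.univ_inter, Finset.sum_const, nsmul_eq_mul, mul_one]
  have hna : ∀ k : Fin a, (((((Finset.univ.erase k).erase ((finRotate a).symm k)).erase (finRotate a k))).card : ℝ) ≤ a := fun k => by exact_mod_cast card_nonAdj_le k
  have step1 := Finset.sum_le_sum (s := Finset.univ) fun k (_ : k ∈ Finset.univ) =>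
    Finset.sum_le_sum (s := (((Finset.univ.erase k).erase ((finRotate a).symm k)).erase (finRotate a k))) fun k' (_ : k' ∈ (((Finset.univ.erase k).erase ((finRotate a).symm k)).erase (finRotate a k))) => quad_perturb_pt X c₄ c hc0 hca ρ ρ' k k'
  refine step1.trans ?_
  simp only [Finset.sum_add_distrib]
  have b2 : ∑ k : Fin a, ∑ _k' ∈ (((Finset.univ.erase k).erase ((finRotate a).symm k)).erase (finRotate a k)), |c₄ - c| ≤ (a : ℝ) * a * |c₄ - c| := by
    calc ∑ k : Fin a, ∑ _k' ∈ (((Finset.univ.erase k).erase ((finRotate a).symm k)).erase (finRotate a k)), |c₄ - c| = ∑ k : Fin a, (((((Finset.univ.erase k).erase ((finRotate a).symm k)).erase (finRotate a k))).card : ℝ) * |c₄ - c| := by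
          simp [Finset.sum_const, nsmul_eq_mul]
      _ ≤ ∑ _k : Fin a, (a : ℝ) * |c₄ - c| := Finset.sum_le_sum fun k _ => by
          have := hna k; have h0 := abs_nonneg (c₄ - c); nlinarith
      _ = (a : ℝ) * a * |c₄ - c| := by simp; ring
  have b3 : ∑ k : Fin a, ∑ _k' ∈ (((Finset.univ.erase k).erase ((finRotate a).symm k)).erase (finRotate a k)), (a : ℝ) * (if k ∈ C then (1 : ℝ) else 0) ≤ (a : ℝ) * a * C.card := by
    calc ∑ k : Fin a, ∑ _k' ∈ (((Finset.univ.erase k).erase ((finRotate a).symm k)).erase (finRotate a k)), (a : ℝ) * (if k ∈ C then (1 : ℝ) else 0)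
        = ∑ k : Fin a, (((((Finset.univ.erase k).erase ((finRotate a).symm k)).erase (finRotate a k))).card : ℝ) * ((a : ℝ) * (if k ∈ C then (1 : ℝ) else 0)) := by
          simp [Finset.sum_const, nsmul_eq_mul]
      _ ≤ ∑ k : Fin a, (a : ℝ) * ((a : ℝ) * (if k ∈ C then (1 : ℝ) else 0)) := Finset.sum_le_sum fun k _ => by
          have := hna k
          have h0 : 0 ≤ (a : ℝ) * (if k ∈ C then (1 : ℝ) else 0) := by positivity
          nlinarith
      _ = (a : ℝ) * a * C.card := by rw [← Finset.mul_sum, ← Finset.mul_sum, hCsum]; ring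
  have b4 : ∑ k : Fin a, ∑ k' ∈ (((Finset.univ.erase k).erase ((finRotate a).symm k)).erase (finRotate a k)), (a : ℝ) * (if k' ∈ C then (1 : ℝ) else 0) ≤ (a : ℝ) * a * C.card := by
    calc ∑ k : Fin a, ∑ k' ∈ (((Finset.univ.erase k).erase ((finRotate a).symm k)).erase (finRotate a k)), (a : ℝ) * (if k' ∈ C then (1 : ℝ) else 0)
        ≤ ∑ _k : Fin a, ∑ k' : Fin a, (a : ℝ) * (if k' ∈ C then (1 : ℝ) else 0) :=
          Finset.sum_le_sum fun k _ =>
            Finset.sum_le_sum_of_subset_of_nonneg (Finset.subset_univ _) fun _ _ _ => by positivity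
      _ = (a : ℝ) * a * C.card := by rw [← Finset.mul_sum, hCsum]; simp; ring
  linarith [b2, b3, b4]

/-- Splitting `univ.erase k` into non-adjacent positions and the two neighbours. -/
lemma sum_erase_le_nonAdj {g : Fin a → ℝ} (hg : ∀ k', 0 ≤ g k') (hgA : ∀ k', g k' ≤ a) (k : Fin a) :
    ∑ k' ∈ Finset.univ.erase k, g k' ≤ (∑ k' ∈ (((Finset.univ.erase k).erase ((finRotate a).symm k)).erase (finRotate a k)), g k') + 2 * a := by
  classical
  have hsub : Finset.univ.erase k ⊆ (((Finset.univ.erase k).erase ((finRotate a).symm k)).erase (finRotate a k)) ∪ {((finRotate a).symm k), finRotate a k} := by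
    intro k' hk'
    rw [Finset.mem_erase] at hk'
    rw [Finset.mem_union, mem_nonAdj, Finset.mem_insert, Finset.mem_singleton]
    by_cases h1 : k' = ((finRotate a).symm k)
    · right; left; exact h1
    by_cases h2 : k' = finRotate a k
    · right; right; exact h2
    left; exact ⟨h2, h1, hk'.1⟩
  calc ∑ k' ∈ Finset.univ.erase k, g k' ≤ ∑ k' ∈ (((Finset.univ.erase k).erase ((finRotate a).symm k)).erase (finRotate a k)) ∪ {((finRotate a).symm k), finRotate a k}, g k' :=
        Finset.sum_le_sum_of_subset_of_nonneg hsub fun _ _ _ => hg _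
    _ ≤ (∑ k' ∈ (((Finset.univ.erase k).erase ((finRotate a).symm k)).erase (finRotate a k)), g k') + ∑ k' ∈ ({((finRotate a).symm k), finRotate a k} : Finset (Fin a)), g k' := by
        have h := Finset.sum_union_inter (s₁ := (((Finset.univ.erase k).erase ((finRotate a).symm k)).erase (finRotate a k))) (s₂ := ({((finRotate a).symm k), finRotate a k} : Finset (Fin a)))
          (f := g)
        have h0 : 0 ≤ ∑ k' ∈ (((Finset.univ.erase k).erase ((finRotate a).symm k)).erase (finRotate a k)) ∩ ({((finRotate a).symm k), finRotate a k} : Finset (Fin a)), g k' :=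
          Finset.sum_nonneg fun _ _ => hg _
        linarith
    _ ≤ (∑ k' ∈ (((Finset.univ.erase k).erase ((finRotate a).symm k)).erase (finRotate a k)), g k') + 2 * a := by
        gcongr
        calc ∑ k' ∈ ({((finRotate a).symm k), finRotate a k} : Finset (Fin a)), g k'
            ≤ ∑ _k' ∈ ({((finRotate a).symm k), finRotate a k} : Finset (Fin a)), (a : ℝ) := Finset.sum_le_sum fun k' _ => hgA k'
          _ = (({((finRotate a).symm k), finRotate a k} : Finset (Fin a)).card : ℝ) * a := by
              rw [Finset.sum_const, nsmul_eq_mul]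
          _ ≤ 2 * a := by
              gcongr
              exact_mod_cast Finset.card_le_two


/-- Pure real bookkeeping: the precision bound `3η₁ + η₂ + 1/a ≤ 1/R`. -/
lemma arith_eta {a R D₃ E η₁ η₂ dev1 dev2 nC cc : ℝ} (hR : 1 ≤ R) (hD₃ : D₃ = 512 * R) (hE : E = 2048 * R)
    (ha : 1024 * R ≤ a)
    (hη₁ : η₁ * a ^ 2 = dev1 + a * nC) (hη₂ : η₂ * a ^ 3 = dev2 + a * a * cc + 2 * (a * a) * nC + 2 * a * a)
    (hdev1 : dev1 ≤ 16 * (a ^ 2 / D₃) + 8) (hdev2 : dev2 ≤ 16 * (a ^ 3 / D₃) + 8)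
    (hcc : cc ≤ a / D₃) (hnC : nC ≤ 64 * (a / E) + 32) :
    3 * η₁ + η₂ + 1 / a ≤ 1 / R := by
  have ha1 : 1 ≤ a := by nlinarith
  have hapos : 0 < a := by linarith
  have hRpos : 0 < R := by linarith
  have hD₃pos : 0 < D₃ := by rw [hD₃]; positivity
  have hEpos : 0 < E := by rw [hE]; positivity
  have u₁ : η₁ ≤ 16 / D₃ + 64 / E + 40 / a := by
    have e0 : η₁ = (dev1 + a * nC) / a ^ 2 := by rw [← hη₁]; field_simp
    rw [e0, div_le_iff₀ (by positivity)]
    have e1 : (16 / D₃ + 64 / E + 40 / a) * a ^ 2 = 16 * (a ^ 2 / D₃) + 64 * a * (a / E) + 40 * a := by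
      field_simp
    rw [e1]
    have h1 : a * nC ≤ a * (64 * (a / E) + 32) := by gcongr
    have e2 : a * (64 * (a / E) + 32) = 64 * a * (a / E) + 32 * a := by ring
    rw [e2] at h1
    have e3 : (8 : ℝ) ≤ 8 * a := by linarith
    linarith
  have u₂ : η₂ ≤ 17 / D₃ + 128 / E + 74 / a := by
    have e0 : η₂ = (dev2 + a * a * cc + 2 * (a * a) * nC + 2 * a * a) / a ^ 3 := by rw [← hη₂]; field_simp
    rw [e0, div_le_iff₀ (by positivity)]
    have e1 : (17 / D₃ + 128 / E + 74 / a) * a ^ 3 = 17 * (a ^ 3 / D₃) + 128 * (a * a * (a / E)) + 74 * (a * a) := by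
      field_simp
    rw [e1]
    have v1 : a * a * cc ≤ a * a * (a / D₃) := by gcongr
    have v2 : 2 * (a * a) * nC ≤ 2 * (a * a) * (64 * (a / E) + 32) := by gcongr
    have e2 : a * a * (a / D₃) = a ^ 3 / D₃ := by ring
    have e3 : 2 * (a * a) * (64 * (a / E) + 32) = 128 * (a * a * (a / E)) + 64 * (a * a) := by ring
    rw [e2] at v1
    rw [e3] at v2
    have e4 : (8 : ℝ) ≤ 8 * (a * a) := by nlinarith
    have e5 : 2 * a * a = 2 * (a * a) := by ring
    rw [e5]
    linarith
  have u₃ : 3 * η₁ + η₂ + 1 / a ≤ 65 / D₃ + 320 / E + 195 / a := by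
    have e : (65 : ℝ) / D₃ + 320 / E + 195 / a =
        3 * (16 / D₃ + 64 / E + 40 / a) + (17 / D₃ + 128 / E + 74 / a) + 1 / a := by ring
    rw [e]; linarith
  refine u₃.trans ?_
  rw [hD₃, hE]
  have hinv : (1 : ℝ) / a ≤ 1 / (1024 * R) := one_div_le_one_div_of_le (by positivity) ha
  calc (65 : ℝ) / (512 * R) + 320 / (2048 * R) + 195 / a
      = 65 / 512 * (1 / R) + 320 / 2048 * (1 / R) + 195 * (1 / a) := by ring
    _ ≤ 65 / 512 * (1 / R) + 320 / 2048 * (1 / R) + 195 * (1 / (1024 * R)) := by gcongr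
    _ = (65 / 512 + 320 / 2048 + 195 / 1024) * (1 / R) := by ring
    _ ≤ 1 * (1 / R) := by gcongr; norm_num
    _ = 1 / R := by ring

/-- Pure real bookkeeping: the square-root chain. -/
lemma sqrt_bound {q ε Q D₂ R S : ℝ} (hQ : 0 < Q) (hD₂ : 0 < D₂) (hq : 0 < q) (hqD : 1 ≤ q * D₂)
    (hR : R = (16 * Q ^ 2 * D₂) ^ 2) (hε : ε = Real.sqrt S) (hS : S ≤ 1 / R) :
    Real.sqrt (ε / q) ≤ 1 / (4 * Q) := by
  have hε0 : 0 ≤ ε := by rw [hε]; exact Real.sqrt_nonneg _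
  have hεb : ε ≤ 1 / (16 * Q ^ 2 * D₂) := by
    rw [hε]
    calc Real.sqrt S ≤ Real.sqrt (1 / R) := Real.sqrt_le_sqrt hS
      _ = 1 / (16 * Q ^ 2 * D₂) := by
          rw [hR, Real.sqrt_div' _ (by positivity), Real.sqrt_one, Real.sqrt_sq (by positivity)]
  have hβinv : ε / q ≤ ε * D₂ := by
    rw [div_le_iff₀ hq]; nlinarith
  have h1 : ε / q ≤ (1 / (4 * Q)) ^ 2 := by
    refine hβinv.trans ?_
    calc ε * D₂ ≤ 1 / (16 * Q ^ 2 * D₂) * D₂ := by gcongr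
      _ = (1 / (4 * Q)) ^ 2 := by field_simp; ring
  calc Real.sqrt (ε / q) ≤ Real.sqrt ((1 / (4 * Q)) ^ 2) := Real.sqrt_le_sqrt h1
    _ = 1 / (4 * Q) := Real.sqrt_sq (by positivity)

/-- ℕ bookkeeping: from a real bound to a floor bound. -/
lemma nat_le_div_add {n a b k : ℕ} (hb : 0 < b) (h : (n : ℝ) ≤ (a : ℝ) / b + k) : n ≤ a / b + k := by
  have hbR : (0 : ℝ) < b := by exact_mod_cast hb
  have h3 : ((n - k : ℕ) : ℝ) ≤ (a : ℝ) / b := by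
    rcases le_or_gt k n with hk | hk
    · push_cast [hk]; linarith
    · rw [Nat.sub_eq_zero_of_le hk.le]; push_cast; positivity
  have h4 : n - k ≤ a / b := by
    rw [Nat.le_div_iff_mul_le hb]
    have : ((n - k : ℕ) : ℝ) * b ≤ a := by rwa [le_div_iff₀ hbR] at h3
    exact_mod_cast this
  omega

/-- ℕ bookkeeping: the minimum degree `L = min t (w - #C)` is at least `a/(2Q)`. -/
lemma nat_L {a Q Cc t w : ℕ} (hQ : 0 < Q) (ha : 96 * Q ≤ a) (hCc : Cc ≤ a / (32 * Q) + 32)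
    (hw : a / Q ≤ w) (ht : a / (2 * Q) ≤ t) : a / (2 * Q) ≤ min t (w - Cc) := by
  have i1 : 16 * (a / (32 * Q)) ≤ a / (2 * Q) := by
    rw [show 32 * Q = 2 * Q * 16 by ring, ← Nat.div_div_eq_div_mul]
    exact Nat.mul_div_le (a / (2 * Q)) 16 |>.trans' (by rw [mul_comm])
  have i2 : 2 * (a / (2 * Q)) ≤ a / Q := by
    rw [show 2 * Q = Q * 2 by ring, ← Nat.div_div_eq_div_mul]
    exact Nat.mul_div_le (a / Q) 2 |>.trans' (by rw [mul_comm])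
  have i4 : 3 ≤ a / (32 * Q) := by
    rw [Nat.le_div_iff_mul_le (by omega)]
    calc 3 * (32 * Q) = 96 * Q := by ring
      _ ≤ a := ha
  exact le_min ht (by omega)

/-- Auxiliary real inequality. -/
lemma aux_key {a : ℝ} (ha : 16 ≤ a) : a ^ 3 ≤ 2 * ((a - 1) * (a - 2) * (a - 3)) := by
  have h1 : 0 ≤ a - 12 := by linarith
  have h2 : 0 ≤ a ^ 2 * (a - 12) := mul_nonneg (sq_nonneg a) h1
  nlinarith [h2]

/-- Auxiliary real inequality. -/
lemma aux1 {a D : ℝ} (ha : 2 ≤ a) (hD : 0 < D) : a ^ 3 / D / (a - 1) ≤ 2 * (a ^ 2 / D) := by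
  have ham1 : 0 < a - 1 := by linarith
  rw [div_le_iff₀ ham1]
  have e : a ^ 3 / D = a * (a ^ 2 / D) := by ring
  rw [e]
  have h0 : 0 ≤ a ^ 2 / D := by positivity
  nlinarith

/-- Auxiliary real inequality. -/
lemma aux2 {a D : ℝ} (ha : 16 ≤ a) (hD : 0 < D) :
    a * (a ^ 5 / D) / ((a - 1) * (a - 2) * (a - 3)) ≤ 2 * (a ^ 3 / D) := by
  have e1 : 0 < a - 1 := by linarith
  have e2 : 0 < a - 2 := by linarith
  have e3 : 0 < a - 3 := by linarith
  have hden : (0 : ℝ) < (a - 1) * (a - 2) * (a - 3) := mul_pos (mul_pos e1 e2) e3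
  rw [div_le_iff₀ hden]
  have e4 : a * (a ^ 5 / D) = a ^ 3 * (a ^ 3 / D) := by ring
  rw [e4]
  have key := aux_key ha
  have h0 : (0 : ℝ) ≤ a ^ 3 / D := by positivity
  nlinarith

/-- Auxiliary real inequality. -/
lemma aux3 {a E : ℝ} (ha : 2 ≤ a) (hE : 0 < E) : a * (a / E) / (a - 1) ≤ 2 * (a / E) := by
  have ham1 : 0 < a - 1 := by linarith
  rw [div_le_iff₀ ham1]
  have h0 : 0 ≤ a / E := by positivity
  nlinarith

/-- Auxiliary real inequality. -/
lemma aux5 {a Q R : ℝ} (ha : 0 ≤ a) (h : Q ≤ R) (hQ : 0 < Q) (hR : 0 < R) :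
    64 * (a / (2048 * R)) ≤ a / (32 * Q) := by
  rw [mul_div_assoc', div_le_div_iff₀ (by positivity) (by positivity)]
  have := mul_le_mul_of_nonneg_left h ha
  nlinarith

/-- **Registered form of `colW_perturb` (ordered factor, part 3).**  A column keeps all but `#C` of its consecutive
pairs when the consecutive value pairs of the order change exactly on the position set `C`. [folklore] -/
theorem orderedFactor_columnPerturb :
    ∀ (a : ℕ) (X : Finset (Fin a × Fin a)) (ρ ρ' : Equiv.Perm (Fin a)) (y : Fin a), (Finset.univ.filter fun kk : Fin a => (ρ kk, y) ∈ X ∧ (ρ ((finRotate a).symm kk), y) ∈ X).card ≤ (Finset.univ.filter fun kk : Fin a => (ρ' kk, y) ∈ X ∧ (ρ' ((finRotate a).symm kk), y) ∈ X).card + (Finset.univ.filter fun k : Fin a => (ρ' k, ρ' ((finRotate a).symm k)) ≠ (ρ k, ρ ((finRotate a).symm k))).card :=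
  fun _a X ρ ρ' y => colW_perturb X ρ ρ' y

end Summit.ValiantsHypothesis.ValiantsHypothesis.Theorems.DivisionGap.PerMultiplesHard.OrderedFactor

end
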